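import Literature.Analysis.Complex.LocallyUniformLimitSCV
import Mathlib.Topology.UniformSpace.Ascoli
import Mathlib.Topology.ContinuousMap.Compact
import HarnessLib

/-!
# Montel's theorem in several complex variables

Trunk support (complex analysis in several variables), the compactness input of the Cartan–Serre
finiteness theorem by the Čech method (H. Cartan, J.-P. Serre (1953); H. Grauert, R. Remmert,
*Theorie der Steinschen Räume* (1977), Kap. VI: "die Restriktionsabbildung … ist kompakt" for
square-integrable / bounded holomorphic cochains on a relatively compact refinement).

**Montel's theorem** (P. Montel 1907 in one variable; in several variables it follows the same
way from Cauchy's inequalities, L. Hörmander, *An Introduction to Complex Analysis in Several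
Variables* (1973), Thm. 2.2.7, and is used as "der klassische Satz von Montel" by H. Grauert,
R. Remmert, *Theorie der Steinschen Räume* (1977), Kap. VI §1, proof of Satz 4: a locally bounded
family of holomorphic maps on an open subset of `ℂⁿ` is relatively compact for compact
convergence). We prove the sequential form for maps `E → F` between a finite-dimensional complex normed
space `E` and a proper complete complex normed space `F` (e.g. finite-dimensional), exactly as the
tree's one-variable `Literature/Analysis/Complex/Montel.lean` (`Complex.exists_strictMono_…`), the
one-variable Cauchy estimate being replaced by the several-variable operator-norm estimate
`Literature.Analysis.Complex.SCV.norm_fderiv_le_of_closedBall_two_mul`: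

* `SCV.exists_ball_norm_sub_le_of_locally_bounded` — a locally bounded family of holomorphic maps
  is locally uniformly Lipschitz (Cauchy estimate + mean value inequality on a ball);
* `SCV.exists_strictMono_tendstoLocallyUniformlyOn` — **Montel**: a locally bounded sequence of
  holomorphic maps on an open `U` has a locally uniformly convergent subsequence (Arzelà–Ascoli in
  `C(U, F)`, Mathlib's `ArzelaAscoli.isCompact_closure_of_isClosedEmbedding`);
* `SCV.exists_strictMono_tendstoLocallyUniformlyOn_of_norm_le` — the uniformly bounded case, with
  the limit recorded to be holomorphic (several-variable Weierstrass theorem of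
  `LocallyUniformLimitSCV`);
* `SCV.exists_strictMono_tendstoUniformlyOn_of_norm_le` — the same with uniform convergence on a
  given compact `K ⊆ U` (the form consumed by the compactness of restriction maps of bounded
  holomorphic cochains).

Everything is PROVED; no definitions.

## References

* L. Hörmander, *An Introduction to Complex Analysis in Several Variables* (1973), Thm. 2.2.7
  (Cauchy's inequalities). [HormanderSCV1973]
* H. Grauert, R. Remmert, *Theorie der Steinschen Räume* (1977), Kap. VI §1 Satz 4, §4.1.
  [GrauertRemmert1977]
* J. B. Conway, *Functions of one complex variable I* (1978), Ch. VII Thm. 2.9 (the one-variable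
  model of the proof).
-/

noncomputable section

open Filter Metric Set Topology Function

namespace Literature.Analysis.Complex.SCV

variable {E : Type*} [NormedAddCommGroup E] [NormedSpace ℂ E]
  {F : Type*} [NormedAddCommGroup F] [NormedSpace ℂ F]
  {U : Set E} {ι : Type*}

/-- **Local Lipschitz bound for locally bounded holomorphic families in several variables** (the
equicontinuity step of Montel's theorem): if the holomorphic maps `f i : E → F` on an open set `U`
are locally bounded, then around each point of `U` there is a ball in `U` on which all `f i` are
Lipschitz with one constant. Proof: the operator-norm Cauchy estimate `‖D(f i)(x)‖ ≤ M / R` on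
`B̄(a, R)` from the bound `M` on `B̄(a, 2R)` (`norm_fderiv_le_of_closedBall_two_mul`), then the mean
value inequality on the convex ball. [cite: HormanderSCV1973, Thm 2.2.7 (Cauchy's inequalities)] -/
theorem exists_ball_norm_sub_le_of_locally_bounded (hU : IsOpen U) {f : ι → E → F}
    (hf : ∀ i, DifferentiableOn ℂ (f i) U)
    (hb : ∀ a ∈ U, ∃ M : ℝ, ∃ r > 0, ∀ i, ∀ z ∈ ball a r ∩ U, ‖f i z‖ ≤ M) {a : E} (ha : a ∈ U) :
    ∃ R > 0, ∃ L : ℝ, ball a R ⊆ U ∧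
      ∀ i, ∀ z ∈ ball a R, ∀ w ∈ ball a R, ‖f i z - f i w‖ ≤ L * ‖z - w‖ := by
  obtain ⟨M, r₁, hr₁, hM⟩ := hb a ha
  obtain ⟨r₂, hr₂, hr₂U⟩ := nhds_basis_closedBall.mem_iff.1 (hU.mem_nhds ha)
  obtain ⟨R, hR0, h2R₁, h2R₂⟩ : ∃ R : ℝ, 0 < R ∧ 2 * R < r₁ ∧ 2 * R ≤ r₂ :=
    ⟨min r₁ r₂ / 4, by positivity,
      by linarith [min_le_left r₁ r₂, lt_min hr₁ hr₂], by linarith [min_le_right r₁ r₂]⟩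
  have hsubU : closedBall a (2 * R) ⊆ U := (closedBall_subset_closedBall h2R₂).trans hr₂U
  have hsub₁ : closedBall a (2 * R) ⊆ ball a r₁ := closedBall_subset_ball h2R₁
  -- a nonnegative bound on `B̄(a, 2R)`
  have hM' : ∀ i, ∀ z ∈ closedBall a (2 * R), ‖f i z‖ ≤ max M 0 := fun i z hz ↦
    (hM i z ⟨hsub₁ hz, hsubU hz⟩).trans (le_max_left _ _)
  have hballU : ball a R ⊆ U :=
    ball_subset_closedBall.trans ((closedBall_subset_closedBall (by linarith)).trans hsubU)
  -- Cauchy's estimate on `B̄(a, R)`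
  have hderiv : ∀ i, ∀ z ∈ ball a R, ‖fderiv ℂ (f i) z‖ ≤ max M 0 / R := fun i z hz ↦
    norm_fderiv_le_of_closedBall_two_mul (hf i) hU hR0 hsubU (le_max_right _ _) (hM' i)
      (ball_subset_closedBall hz)
  refine ⟨R, hR0, max M 0 / R, hballU, fun i z hz w hw ↦ ?_⟩
  have hdiff : ∀ x ∈ ball a R, DifferentiableAt ℂ (f i) x := fun x hx ↦
    (hf i).differentiableAt (hU.mem_nhds (hballU hx))
  exact (convex_ball a R).norm_image_sub_le_of_norm_fderiv_le hdiff (hderiv i) hw hz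

variable [FiniteDimensional ℂ E] [CompleteSpace F] [ProperSpace F]

/-- **Montel's theorem in several complex variables** (sequential form of "locally bounded ⇒
normal"; Grauert–Remmert (1977), Kap. VI §1, proof of Satz 4, "nach dem klassischen Satz von
Montel"). Let `U` be an open subset of a finite-dimensional complex normed space
`E`, `F` a proper complete complex normed space, and let `f : ℕ → E → F` be holomorphic on `U` and
locally bounded on `U`. Then some subsequence `f ∘ φ` converges locally uniformly on `U`. Proof:
Arzelà–Ascoli in `C(U, F)` (Mathlib's `ArzelaAscoli.isCompact_closure_of_isClosedEmbedding`), the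
equicontinuity being `exists_ball_norm_sub_le_of_locally_bounded`; verbatim the tree's one-variable
`Complex.exists_strictMono_tendstoLocallyUniformlyOn`. [cite: HormanderSCV1973, Thm 2.2.7 (Cauchy's inequalities)] -/
theorem exists_strictMono_tendstoLocallyUniformlyOn (hU : IsOpen U) {f : ℕ → E → F}
    (hf : ∀ n, DifferentiableOn ℂ (f n) U)
    (hb : ∀ a ∈ U, ∃ M : ℝ, ∃ r > 0, ∀ n, ∀ z ∈ ball a r ∩ U, ‖f n z‖ ≤ M) :
    ∃ g : E → F, ∃ φ : ℕ → ℕ, StrictMono φ ∧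
      TendstoLocallyUniformlyOn (fun n ↦ f (φ n)) g atTop U := by
  classical
  haveI : ProperSpace E := FiniteDimensional.proper_rclike ℂ E
  haveI : LocallyCompactSpace U := hU.locallyCompactSpace
  -- the restrictions to `U`, as elements of `C(U, F)`
  obtain ⟨G, hG⟩ : ∃ G : ℕ → C(U, F), ∀ n, ∀ x : U, G n x = f n x :=
    ⟨fun n ↦ ⟨U.restrict (f n), (hf n).continuousOn.restrict⟩, fun _ _ ↦ rfl⟩
  -- `C(U, F) → (U →ᵤ[compacts] F)` is a closed embedding (`U` is locally compact)
  have hce : IsClosedEmbedding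
      (UniformOnFun.ofFun {K : Set U | IsCompact K} ∘ fun g : C(U, F) ↦ (⇑g : U → F)) := by
    refine ⟨ContinuousMap.isUniformEmbedding_toUniformOnFunIsCompact.isEmbedding, ?_⟩
    change IsClosed (range (ContinuousMap.toUniformOnFunIsCompact : C(U, F) → _))
    rw [ContinuousMap.range_toUniformOnFunIsCompact]
    exact UniformOnFun.isClosed_setOf_continuous CompactlyCoherentSpace.isCoherentWith
  -- the family `{G n}` is equicontinuous
  have heq : Equicontinuous
      ((fun g : C(U, F) ↦ (⇑g : U → F)) ∘ ((↑) : range G → C(U, F))) := by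
    intro x₀
    rw [Metric.equicontinuousAt_iff]
    intro ε hε
    obtain ⟨R, hR, L, -, hL⟩ := exists_ball_norm_sub_le_of_locally_bounded hU hf hb x₀.2
    refine ⟨min R (ε / (|L| + 1)), lt_min hR (by positivity), ?_⟩
    rintro x hx ⟨_, n, rfl⟩
    change dist (G n x₀) (G n x) < ε
    rw [hG, hG, dist_eq_norm]
    have hxR : (x : E) ∈ ball (x₀ : E) R :=
      mem_ball.2 (lt_of_lt_of_le hx (min_le_left _ _))
    have hxε : ‖(x₀ : E) - x‖ < ε / (|L| + 1) := by
      rw [← dist_eq_norm, dist_comm]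
      exact lt_of_lt_of_le hx (min_le_right _ _)
    have hpos : 0 < |L| + 1 := by positivity
    calc ‖f n x₀ - f n x‖ ≤ L * ‖(x₀ : E) - x‖ := hL n x₀ (mem_ball_self hR) x hxR
      _ ≤ (|L| + 1) * ‖(x₀ : E) - x‖ := by gcongr; linarith [le_abs_self L]
      _ < (|L| + 1) * (ε / (|L| + 1)) := by gcongr
      _ = ε := by field_simp
  -- pointwise boundedness
  have hpt : ∀ K ∈ {K : Set U | IsCompact K}, ∀ x ∈ K, ∃ Q : Set F, IsCompact Q ∧
      ∀ i ∈ range G, (fun g : C(U, F) ↦ (⇑g : U → F)) i x ∈ Q := by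
    intro K _ x _
    obtain ⟨M, r, hr, hM⟩ := hb x x.2
    refine ⟨closedBall 0 M, isCompact_closedBall _ _, ?_⟩
    rintro _ ⟨n, rfl⟩
    change G n x ∈ closedBall (0 : F) M
    rw [hG, mem_closedBall_zero_iff]
    exact hM n x ⟨mem_ball_self hr, x.2⟩
  have hcpt : IsCompact (closure (range G)) :=
    ArzelaAscoli.isCompact_closure_of_isClosedEmbedding (F := fun g : C(U, F) ↦ (⇑g : U → F))
      (fun K hK ↦ hK) hce (fun K _ ↦ heq.equicontinuousOn K) hpt
  obtain ⟨g, -, φ, hφ, hlim⟩ :=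
    hcpt.tendsto_subseq (x := G) fun n ↦ subset_closure (mem_range_self n)
  rw [ContinuousMap.tendsto_iff_tendstoLocallyUniformly] at hlim
  refine ⟨fun z ↦ if hz : z ∈ U then g ⟨z, hz⟩ else 0, φ, hφ, ?_⟩
  rw [tendstoLocallyUniformlyOn_iff_tendstoLocallyUniformly_comp_coe]
  have h1 : (fun i (x : U) ↦ f (φ i) (x : E)) = fun i a ↦ (G ∘ φ) i a := by
    funext i x
    simp [hG]
  have h2 : ((fun z ↦ if hz : z ∈ U then g ⟨z, hz⟩ else 0) ∘ ((↑) : U → E)) = ⇑g := by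
    funext x
    simp [x.2]
  rw [h1, h2]
  exact hlim

/-- **Montel's theorem in several variables, uniformly bounded case, with the holomorphy of the
limit**: a sequence of holomorphic maps on an open `U`, bounded by one constant on `U`, has a
locally uniformly convergent subsequence whose limit is holomorphic on `U` (several-variable
Weierstrass theorem, `differentiableOn_of_tendstoLocallyUniformlyOn`). [cite: HormanderSCV1973, §2.2 (Cor. 2.2.5, Thm 2.2.7)] -/
theorem exists_strictMono_tendstoLocallyUniformlyOn_of_norm_le (hU : IsOpen U) {f : ℕ → E → F}
    {M : ℝ} (hf : ∀ n, DifferentiableOn ℂ (f n) U) (hM : ∀ n, ∀ z ∈ U, ‖f n z‖ ≤ M) :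
    ∃ g : E → F, ∃ φ : ℕ → ℕ, StrictMono φ ∧ DifferentiableOn ℂ g U ∧
      TendstoLocallyUniformlyOn (fun n ↦ f (φ n)) g atTop U := by
  obtain ⟨g, φ, hφ, hlim⟩ := exists_strictMono_tendstoLocallyUniformlyOn hU hf
    fun _ _ ↦ ⟨M, 1, one_pos, fun n _ hz ↦ hM n _ hz.2⟩
  exact ⟨g, φ, hφ, differentiableOn_of_tendstoLocallyUniformlyOn hU (fun n ↦ hf (φ n)) hlim, hlim⟩

/-- **Montel's theorem, the form used for the compactness of restriction maps** (Grauert–Remmert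
(1977), Kap. VI §1 Satz 4 / §4.1: restriction of bounded holomorphic cochains to a relatively
compact refinement is a compact operator): a sequence of holomorphic maps on an open `U` bounded by
one constant on `U` has a subsequence converging UNIFORMLY on any given compact `K ⊆ U` to a map
holomorphic on `U` (and bounded by the same constant on `U`). [cite: GrauertRemmert1977, Kap. VI §1 Satz 4] -/
theorem exists_strictMono_tendstoUniformlyOn_of_norm_le (hU : IsOpen U) {K : Set E} (hK : IsCompact K)
    (hKU : K ⊆ U) {f : ℕ → E → F} {M : ℝ} (hf : ∀ n, DifferentiableOn ℂ (f n) U)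
    (hM : ∀ n, ∀ z ∈ U, ‖f n z‖ ≤ M) :
    ∃ g : E → F, ∃ φ : ℕ → ℕ, StrictMono φ ∧ DifferentiableOn ℂ g U ∧ (∀ z ∈ U, ‖g z‖ ≤ M) ∧
      TendstoUniformlyOn (fun n ↦ f (φ n)) g atTop K := by
  haveI : ProperSpace E := FiniteDimensional.proper_rclike ℂ E
  obtain ⟨g, φ, hφ, hg, hlim⟩ := exists_strictMono_tendstoLocallyUniformlyOn_of_norm_le hU hf hM
  refine ⟨g, φ, hφ, hg, fun z hz ↦ ?_, (tendstoLocallyUniformlyOn_iff_forall_isCompact hU).1 hlim K hKU hK⟩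
  -- the bound passes to the pointwise limit
  exact le_of_tendsto (Tendsto.norm (hlim.tendsto_at hz)) (Eventually.of_forall fun n ↦ hM _ z hz)

end Literature.Analysis.Complex.SCV

end
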